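import Literature.Analysis.UnboundedOperators.HeatKernelFourier
import Literature.Analysis.FunctionSpaces.PlancherelL1L2
import Mathlib.Analysis.Fourier.FourierTransformDeriv
import Mathlib.Analysis.InnerProductSpace.Laplacian
import Mathlib.Analysis.Calculus.ParametricIntegral
import HarnessLib

/-!
# Backward caloric Fourier syntheses `(s, x) ↦ 𝓕[e^{-(2π)²(t-s)|ξ|²} m(ξ)](x)`

Analysis/UnboundedOperators support file (heat equation on a finite-dimensional real inner
product space `V`, Mathlib's Fourier integral `𝓕 m x = ∫ 𝐞(-⟪ξ, x⟫) m ξ dξ`). It is the bottom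
layer of the Fourier-side proof of Tao 2011, Prop. 9.1 (bounded total speed; the tested Duhamel
formula of a finite-energy classical Navier–Stokes solution against backward caloric test fields,
`FluidPDE/NSCaloricCurlTest.lean`, `FluidPDE/TaoDuhamelFourier.lean`).

For a coefficient `m : V → ℂ` and a final time `t` we set

* `caloricWeight t s ξ = heatSymbol (t - s) ξ = exp (-(2π)² (t - s) ‖ξ‖²)` (as a complex number),
* `caloricCoeff t m s ξ = caloricWeight t s ξ * m ξ`,
* `caloricSynth t m s x = 𝓕 (caloricCoeff t m s) x`,

so that `caloricSynth t m s = e^{(t-s)Δ} (𝓕 m)` for `s ≤ t` (`heatExtension_fourier_eq`): the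
backward caloric extension of the synthesis `𝓕 m` from time `t`. Everything is **proved**, with
hypotheses on `m` that are *moment integrability* conditions `∫ ‖ξ‖ᵏ ‖m ξ‖ dξ < ∞` (never
pointwise decay: the solenoidal/gradient coefficients `(ξ × b)/‖ξ‖²`, `(ξ · b)/‖ξ‖²` of a Schwartz
field `b` on `ℝ³`, met downstream, are singular at the origin but have all moments):

* pointwise bound `‖caloricSynth t m s x‖ ≤ ∫ ‖m‖` (`s ≤ t`), joint continuity on `{s ≤ t} × V`
  (`continuousOn_caloricSynth`), value `𝓕 m` at `s = t`;
* space derivatives `∂_h caloricSynth t m s = caloricSynth t (-2πi⟪ξ,h⟫ m) s`, `C^n` regularity,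
  and the Laplacian `Δ caloricSynth t m s = caloricSynth t (-4π²‖ξ‖² m) s` (moment-based forms of
  Mathlib's `Real.fderiv_fourier`, `Real.contDiff_fourier`, `Real.iteratedFDeriv_fourier`);
* the time derivative `∂ₛ caloricSynth t m s x = caloricSynth t ((2π)²‖ξ‖² m) s x = -Δₓ caloricSynth`
  for `s < t` (**backward heat equation**, differentiation under the integral sign);
* the `L²` bound `∫ ‖caloricSynth t m s x‖² dx ≤ ∫ ‖m‖²` (Plancherel on `L¹ ∩ L²`,
  `FunctionSpaces/PlancherelL1L2`);
* the heat flow of a synthesis, `e^{τΔ}(𝓕 m) = 𝓕 (heatSymbol τ · m)` for `m ∈ L¹`, `τ > 0`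
  (Fubini and `𝓕 (heatKernel τ) = heatSymbol τ`, `HeatKernelFourier`), also for real parts.

## Mathlib / tree search

Mathlib: `Real.fourier_eq`, `Real.fderiv_fourier`, `Real.fourier_continuousLinearMap_apply`,
`Real.contDiff_fourier`, `Real.iteratedFDeriv_fourier`, `VectorFourier.fourierPowSMulRight_apply`,
`VectorFourier.norm_fourierIntegral_le_integral_norm`, `continuousOn_of_dominated`,
`hasDerivAt_integral_of_dominated_loc_of_deriv_le`, `laplacian_eq_iteratedFDeriv_orthonormalBasis`,
`OrthonormalBasis.sum_sq_norm_inner_right`, `integral_prod`/`integral_integral_swap`. No Mathlib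
heat semigroup. Tree: `heatSymbol`, `heatKernel`, `heatExtension` (`UnboundedOperators/HeatKernel`),
`fourierIntegral_heatKernel_holds` (`HeatKernelFourier`),
`FunctionSpaces.lintegral_enorm_sq_fourierIntegral_eq` (`PlancherelL1L2`). The tree's
`FluidPDE.FourierNS` dictionary (`NSFourierDictionary`) is keyed to pointwise `HasDecay` and does not
cover singular coefficients; nothing on backward caloric syntheses (`lean search 'caloric|heatSymbol.*fourier'`).

## References

* L. C. Evans, *Partial Differential Equations*, 2nd ed., AMS 2010, §2.3.1 (heat kernel) and
  §4.3.1 (Fourier transform solution of the heat equation). Bib key `Evans2010`.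
* E. M. Stein, *Singular Integrals and Differentiability Properties of Functions*, 1970, Ch. III §2
  (the heat semigroup as the multiplier `e^{-4π²t|ξ|²}`). Bib key `SteinSingularIntegrals1970`.
* T. Tao, *Localisation and compactness properties of the Navier–Stokes global regularity problem*,
  Anal. PDE 6 (2013) = arXiv:1108.1165, §9 (consumer). Bib key `Tao2011`.
-/

noncomputable section

open MeasureTheory Real Set Filter Topology Function Complex VectorFourier InnerProductSpace
open scoped FourierTransform RealInnerProductSpace ENNReal ContDiff Laplacian

namespace Literature.Analysis.UnboundedOperators

variable {V : Type*} [NormedAddCommGroup V]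

/-! ### Moment-based Fourier dictionary (first and second derivatives of a synthesis) -/

section MomentDictionary

variable [InnerProductSpace ℝ V] [FiniteDimensional ℝ V] [MeasurableSpace V] [BorelSpace V]
variable {f : V → ℂ}

/-- An a.e. strongly measurable coefficient with integrable zeroth moment is integrable. [folklore] -/
theorem integrable_of_integrable_pow_zero_mul (hfm : AEStronglyMeasurable f volume)
    (h0 : Integrable fun ξ : V => ‖ξ‖ ^ (0 : ℕ) * ‖f ξ‖) : Integrable f := by
  simp only [pow_zero, one_mul] at h0
  exact (integrable_norm_iff hfm).1 h0

/-- Integrability of the derivative symbol `fourierSMulRight (innerSL ℝ) f` from the first moment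
(Mathlib `norm_fourierSMulRight_le`). [folklore] -/
theorem integrable_fourierSMulRight_of_moment (hf : Integrable f)
    (hf1 : Integrable fun ξ : V => ‖ξ‖ * ‖f ξ‖) :
    Integrable (fourierSMulRight (innerSL ℝ) f) := by
  refine (hf1.const_mul (2 * π * ‖(innerSL ℝ : V →L[ℝ] V →L[ℝ] ℝ)‖)).mono'
    (hf.1.fourierSMulRight) (Eventually.of_forall fun ξ => ?_)
  exact (norm_fourierSMulRight_le _ f ξ).trans (le_of_eq (by ring))

/-- **`∂_h 𝓕 f = 𝓕 (-2πi⟪ξ, h⟫ f)`** for a coefficient with integrable zeroth and first moments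
(Mathlib `Real.fderiv_fourier`, evaluated). [folklore] -/
theorem fderiv_fourier_apply_of_moment (hf : Integrable f)
    (hf1 : Integrable fun ξ : V => ‖ξ‖ * ‖f ξ‖) (x h : V) :
    fderiv ℝ (𝓕 f) x h = 𝓕 (fun ξ => (-(2 * π * I) * (⟪ξ, h⟫ : ℂ)) * f ξ) x := by
  rw [Real.fderiv_fourier hf hf1, Real.fourier_continuousLinearMap_apply
    (integrable_fourierSMulRight_of_moment hf hf1)]
  have hfun : (fun ξ : V => fourierSMulRight (innerSL ℝ) f ξ h) =
      fun ξ : V => (-(2 * π * I) * (⟪ξ, h⟫ : ℂ)) * f ξ := by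
    funext ξ
    change -(2 * π * I) • ((⟪ξ, h⟫ : ℝ) • f ξ) = _
    rw [Complex.real_smul, smul_eq_mul]
    ring
  rw [hfun]

/-- **`Δ 𝓕 f = 𝓕 (-4π²‖ξ‖² f)`** for a coefficient with integrable moments of order `≤ 2`: the
orthonormal-basis formula `ΔF = ∑ᵢ D²F[eᵢ, eᵢ]`, Mathlib's `iteratedFDeriv_fourier`, and
`∑ᵢ ⟪eᵢ, ξ⟫² = ‖ξ‖²`. [folklore] -/
theorem laplacian_fourier_of_moment (hfm : AEStronglyMeasurable f volume)
    (hmom : ∀ k : ℕ, k ≤ 2 → Integrable fun ξ : V => ‖ξ‖ ^ k * ‖f ξ‖) (x : V) :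
    (Δ (𝓕 f)) x = 𝓕 (fun ξ => (-(4 * π ^ 2 * ‖ξ‖ ^ 2 : ℝ) : ℂ) * f ξ) x := by
  classical
  set b := stdOrthonormalBasis ℝ V with hb
  have hint : Integrable f := integrable_of_integrable_pow_zero_mul hfm (hmom 0 (by norm_num))
  rw [laplacian_eq_iteratedFDeriv_orthonormalBasis (𝓕 f) b]
  simp only
  rw [Real.iteratedFDeriv_fourier (N := (2 : ℕ)) (fun k hk => hmom k (mod_cast hk)) hfm
    (n := 2) (mod_cast le_rfl)]
  have hI : Integrable fun ξ => fourierPowSMulRight (innerSL ℝ) f ξ 2 :=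
    integrable_fourierPowSMulRight _ (hmom 2 le_rfl) hfm
  set g : Fin (Module.finrank ℝ V) → V → ℂ := fun i ξ =>
    ((-(2 * π * I)) ^ 2 * ((⟪b i, ξ⟫ : ℝ) : ℂ) ^ 2) * f ξ with hg
  have hterm : ∀ i, 𝓕 (fun ξ => fourierPowSMulRight (innerSL ℝ) f ξ 2) x ![b i, b i] =
      𝓕 (g i) x := by
    intro i
    rw [Real.fourier_continuousMultilinearMap_apply hI]
    have hfun : (fun ξ : V => fourierPowSMulRight (innerSL ℝ) f ξ 2 ![b i, b i]) = g i := by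
      funext ξ
      rw [fourierPowSMulRight_apply, Fin.prod_univ_two]
      simp only [Matrix.cons_val_zero, Matrix.cons_val_one]
      change (-(2 * π * I)) ^ 2 • ((⟪ξ, b i⟫ * ⟪ξ, b i⟫ : ℝ) • f ξ) = g i ξ
      rw [Complex.real_smul, smul_eq_mul, real_inner_comm (b i) ξ]
      simp only [hg, Complex.ofReal_mul]
      ring
    rw [hfun]
  simp_rw [hterm]
  have hgi : ∀ i ∈ (Finset.univ : Finset (Fin (Module.finrank ℝ V))), Integrable (g i) := by
    intro i _
    have h2 := hmom 2 le_rfl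
    refine (h2.const_mul (4 * π ^ 2)).mono' ?_ (Eventually.of_forall fun ξ => ?_)
    · exact (Continuous.aestronglyMeasurable (by fun_prop)).mul hfm
    · simp only [hg]
      rw [norm_mul, norm_mul, norm_pow, norm_neg, norm_mul, norm_mul, Complex.norm_two,
        Complex.norm_real, Complex.norm_I, mul_one, Real.norm_eq_abs, abs_of_pos Real.pi_pos,
        norm_pow, Complex.norm_real, Real.norm_eq_abs]
      have h1 : |⟪b i, ξ⟫| ^ 2 ≤ ‖ξ‖ ^ 2 := by
        have := abs_real_inner_le_norm (b i) ξ
        rw [b.orthonormal.1 i, one_mul] at this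
        exact pow_le_pow_left₀ (abs_nonneg _) this 2
      calc (2 * π) ^ 2 * |⟪b i, ξ⟫| ^ 2 * ‖f ξ‖ ≤ (2 * π) ^ 2 * ‖ξ‖ ^ 2 * ‖f ξ‖ := by gcongr
        _ = 4 * π ^ 2 * (‖ξ‖ ^ 2 * ‖f ξ‖) := by ring
  have hsum : ∑ i, 𝓕 (g i) x = 𝓕 (fun ξ => ∑ i, g i ξ) x := by
    simp only [Real.fourier_eq, Finset.smul_sum]
    rw [integral_finsetSum Finset.univ fun i hi =>
      (Real.fourierIntegral_convergent_iff x).2 (hgi i hi)]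
  rw [hsum]
  have hI2 : (-(2 * (π : ℂ) * I)) ^ 2 = -(4 * π ^ 2) := by
    rw [neg_sq, mul_pow, mul_pow, Complex.I_sq]; ring
  have hpar : ∀ ξ : V, (∑ i, ((⟪b i, ξ⟫ : ℝ) : ℂ) ^ 2) = ((‖ξ‖ ^ 2 : ℝ) : ℂ) := by
    intro ξ
    rw [← b.sum_sq_norm_inner_right ξ]
    push_cast
    refine Finset.sum_congr rfl fun i _ => ?_
    rw [Real.norm_eq_abs, ← Complex.ofReal_pow, ← Complex.ofReal_pow, sq_abs]
  have hfun2 : (fun ξ => ∑ i, g i ξ) = fun ξ => (-(4 * π ^ 2 * ‖ξ‖ ^ 2 : ℝ) : ℂ) * f ξ := by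
    funext ξ
    change ∑ i, ((-(2 * π * I)) ^ 2 * ((⟪b i, ξ⟫ : ℝ) : ℂ) ^ 2) * f ξ = _
    rw [← Finset.sum_mul]
    congr 1
    simp only [hI2]
    rw [← Finset.mul_sum, hpar ξ]
    push_cast
    ring
  rw [hfun2]

end MomentDictionary

/-! ### The backward caloric weight and coefficient -/

section Weight

/-- The **backward caloric weight** ending at time `t`, at time `s` and frequency `ξ`:
`heatSymbol (t - s) ξ = exp (-(2π)² (t - s) ‖ξ‖²)` as a complex number (the Fourier multiplier of
`e^{(t-s)Δ}`; meaningful for `s ≤ t`). [folklore] -/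
def caloricWeight (t s : ℝ) (ξ : V) : ℂ := ((heatSymbol (t - s) ξ : ℝ) : ℂ)

/-- Unfolding the weight. [folklore] -/
theorem caloricWeight_apply (t s : ℝ) (ξ : V) :
    caloricWeight t s ξ = ((Real.exp (-(2 * π) ^ 2 * (t - s) * ‖ξ‖ ^ 2) : ℝ) : ℂ) := rfl

/-- At `s = t` the weight is `1`. [folklore] -/
@[simp]
theorem caloricWeight_self (t : ℝ) (ξ : V) : caloricWeight t t ξ = 1 := by
  simp [caloricWeight]

/-- The weight has modulus `≤ 1` for `s ≤ t`. [folklore] -/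
theorem norm_caloricWeight_le_one {t s : ℝ} (h : s ≤ t) (ξ : V) : ‖caloricWeight t s ξ‖ ≤ 1 := by
  rw [caloricWeight, Complex.norm_real, Real.norm_of_nonneg (heatSymbol_pos _ _).le]
  exact heatSymbol_le_one (sub_nonneg.2 h) ξ

/-- The weight is jointly continuous in `(s, ξ)`. [folklore] -/
theorem continuous_caloricWeight (t : ℝ) :
    Continuous fun p : ℝ × V => caloricWeight t p.1 p.2 := by
  unfold caloricWeight heatSymbol
  fun_prop

/-- The weight is continuous in `ξ`. [folklore] -/
theorem continuous_caloricWeight_right (t s : ℝ) : Continuous fun ξ : V => caloricWeight t s ξ :=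
  (continuous_caloricWeight t).comp (Continuous.prodMk_right s)

/-- **Time derivative of the weight**: `∂ₛ e^{-(2π)²(t-s)‖ξ‖²} = (2π)²‖ξ‖² e^{-(2π)²(t-s)‖ξ‖²}`. [folklore] -/
theorem hasDerivAt_caloricWeight (t s : ℝ) (ξ : V) :
    HasDerivAt (fun σ => caloricWeight t σ ξ)
      ((((2 * π) ^ 2 * ‖ξ‖ ^ 2 : ℝ) : ℂ) * caloricWeight t s ξ) s := by
  have h1 : HasDerivAt (fun σ : ℝ => t - σ) (-1) s := by
    simpa using (hasDerivAt_id' s).const_sub t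
  have ha : HasDerivAt (fun σ : ℝ => -(2 * π) ^ 2 * (t - σ) * ‖ξ‖ ^ 2) ((2 * π) ^ 2 * ‖ξ‖ ^ 2) s := by
    have h2 := (h1.const_mul (-(2 * π) ^ 2)).mul_const (‖ξ‖ ^ 2)
    exact h2.congr_deriv (by ring)
  have he := (Real.hasDerivAt_exp _).comp s ha
  have hc := he.ofReal_comp
  simp only [Function.comp_def] at hc
  have hfun : (fun σ => caloricWeight t σ ξ) =
      fun σ => ((Real.exp (-(2 * π) ^ 2 * (t - σ) * ‖ξ‖ ^ 2) : ℝ) : ℂ) := rfl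
  have hval : (((2 * π) ^ 2 * ‖ξ‖ ^ 2 : ℝ) : ℂ) * caloricWeight t s ξ =
      ((Real.exp (-(2 * π) ^ 2 * (t - s) * ‖ξ‖ ^ 2) * ((2 * π) ^ 2 * ‖ξ‖ ^ 2) : ℝ) : ℂ) := by
    rw [caloricWeight_apply]
    push_cast
    ring
  rw [hfun, hval]
  exact hc

end Weight

section Coeff

variable {t s : ℝ} {m : V → ℂ}

/-- The **backward caloric coefficient** `caloricWeight t s ξ * m ξ` of a coefficient `m`. [folklore] -/
def caloricCoeff (t : ℝ) (m : V → ℂ) (s : ℝ) (ξ : V) : ℂ := caloricWeight t s ξ * m ξ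

/-- Unfolding. [folklore] -/
theorem caloricCoeff_apply (t : ℝ) (m : V → ℂ) (s : ℝ) (ξ : V) :
    caloricCoeff t m s ξ = caloricWeight t s ξ * m ξ := rfl

/-- At `s = t` the caloric coefficient is `m`. [folklore] -/
@[simp]
theorem caloricCoeff_self (t : ℝ) (m : V → ℂ) : caloricCoeff t m t = m := by
  funext ξ; simp [caloricCoeff]

/-- A scalar symbol commutes with the weight:
`caloricCoeff t (c · m) s = c · caloricCoeff t m s`. [folklore] -/
theorem caloricCoeff_mul (t : ℝ) (c m : V → ℂ) (s : ℝ) :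
    caloricCoeff t (fun ξ => c ξ * m ξ) s = fun ξ => c ξ * caloricCoeff t m s ξ := by
  funext ξ; simp only [caloricCoeff]; ring

/-- `‖caloricCoeff t m s ξ‖ ≤ ‖m ξ‖` for `s ≤ t`. [folklore] -/
theorem norm_caloricCoeff_le (h : s ≤ t) (ξ : V) : ‖caloricCoeff t m s ξ‖ ≤ ‖m ξ‖ := by
  rw [caloricCoeff, norm_mul]
  exact (mul_le_of_le_one_left (norm_nonneg _) (norm_caloricWeight_le_one h ξ))

variable [InnerProductSpace ℝ V] [FiniteDimensional ℝ V] [MeasurableSpace V] [BorelSpace V]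

/-- Measurability of the caloric coefficient. [folklore] -/
theorem aestronglyMeasurable_caloricCoeff (hm : AEStronglyMeasurable m volume) (t s : ℝ) :
    AEStronglyMeasurable (caloricCoeff t m s) volume :=
  (continuous_caloricWeight_right t s).aestronglyMeasurable.mul hm

/-- Moments of the caloric coefficient are dominated by those of `m` (`s ≤ t`). [folklore] -/
theorem integrable_pow_mul_norm_caloricCoeff (hm : AEStronglyMeasurable m volume) {k : ℕ}
    (hk : Integrable fun ξ : V => ‖ξ‖ ^ k * ‖m ξ‖) (h : s ≤ t) :
    Integrable fun ξ : V => ‖ξ‖ ^ k * ‖caloricCoeff t m s ξ‖ := by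
  refine hk.mono' ?_ (Eventually.of_forall fun ξ => ?_)
  · exact (continuous_norm.pow k).aestronglyMeasurable.mul
      (aestronglyMeasurable_caloricCoeff hm t s).norm
  · rw [Real.norm_of_nonneg (by positivity)]
    exact mul_le_mul_of_nonneg_left (norm_caloricCoeff_le h ξ) (by positivity)

/-- The caloric coefficient of an integrable `m` is integrable (`s ≤ t`). [folklore] -/
theorem integrable_caloricCoeff (hm : Integrable m) (h : s ≤ t) :
    Integrable (caloricCoeff t m s) :=
  hm.norm.mono' (aestronglyMeasurable_caloricCoeff hm.1 t s)
    (Eventually.of_forall fun ξ => norm_caloricCoeff_le h ξ)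

/-- The caloric coefficient of `m ∈ L²` is in `L²` (`s ≤ t`). [folklore] -/
theorem memLp_two_caloricCoeff (hm : MemLp m 2 volume) (h : s ≤ t) :
    MemLp (caloricCoeff t m s) 2 volume :=
  hm.of_le_mul (c := 1) (aestronglyMeasurable_caloricCoeff hm.1 t s)
    (Eventually.of_forall fun ξ => by rw [one_mul]; exact norm_caloricCoeff_le h ξ)

end Coeff

/-! ### The synthesis: bounds, continuity, value at `s = t` -/

section Synth

variable [InnerProductSpace ℝ V] [FiniteDimensional ℝ V] [MeasurableSpace V] [BorelSpace V]
variable {t s : ℝ} {m : V → ℂ}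

/-- The **backward caloric Fourier synthesis** ending at time `t` of the coefficient `m`:
`caloricSynth t m s x = 𝓕 (caloricCoeff t m s) x = ∫ 𝐞(-⟪ξ, x⟫) e^{-(2π)²(t-s)‖ξ‖²} m(ξ) dξ`
(`= e^{(t-s)Δ}(𝓕 m)(x)` for `s ≤ t`; junk for `s > t` when the integral diverges). [folklore] -/
def caloricSynth (t : ℝ) (m : V → ℂ) (s : ℝ) (x : V) : ℂ := 𝓕 (caloricCoeff t m s) x

/-- Unfolding as a Fourier integral. [folklore] -/
theorem caloricSynth_eq_integral (t : ℝ) (m : V → ℂ) (s : ℝ) (x : V) :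
    caloricSynth t m s x = ∫ ξ, 𝐞 (-⟪ξ, x⟫) • caloricCoeff t m s ξ := by
  rw [caloricSynth, Real.fourier_eq]

/-- At `s = t` the synthesis is `𝓕 m`. [folklore] -/
@[simp]
theorem caloricSynth_self (t : ℝ) (m : V → ℂ) : caloricSynth t m t = 𝓕 m := by
  funext x; simp [caloricSynth]

/-- **Pointwise bound** `‖caloricSynth t m s x‖ ≤ ∫ ‖m‖` for `s ≤ t`. [folklore] -/
theorem norm_caloricSynth_le (hm : Integrable m) (h : s ≤ t) (x : V) :
    ‖caloricSynth t m s x‖ ≤ ∫ ξ, ‖m ξ‖ := by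
  refine (VectorFourier.norm_fourierIntegral_le_integral_norm _ _ _ _ _).trans ?_
  exact integral_mono (integrable_caloricCoeff hm h).norm hm.norm fun ξ => norm_caloricCoeff_le h ξ

/-- **Joint continuity** of `(s, x) ↦ caloricSynth t m s x` on `{s ≤ t} × V` for `m ∈ L¹`
(dominated convergence, dominating function `‖m‖`). [folklore] -/
theorem continuousOn_caloricSynth (hm : Integrable m) (t : ℝ) :
    ContinuousOn (fun p : ℝ × V => caloricSynth t m p.1 p.2) (Iic t ×ˢ univ) := by
  have heq : (fun p : ℝ × V => caloricSynth t m p.1 p.2) =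
      fun p : ℝ × V => ∫ ξ, 𝐞 (-⟪ξ, p.2⟫) • caloricCoeff t m p.1 ξ := by
    funext p; exact caloricSynth_eq_integral t m p.1 p.2
  rw [heq]
  refine continuousOn_of_dominated (bound := fun ξ => ‖m ξ‖) ?_ ?_ hm.norm ?_
  · intro p hp
    exact ((Real.fourierIntegral_convergent_iff p.2).2
      (integrable_caloricCoeff hm (mem_prod.1 hp).1)).1
  · intro p hp
    refine Eventually.of_forall fun ξ => ?_
    rw [Circle.norm_smul]
    exact norm_caloricCoeff_le (mem_prod.1 hp).1 ξ
  · refine Eventually.of_forall fun ξ => Continuous.continuousOn ?_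
    have hfun : (fun p : ℝ × V => 𝐞 (-⟪ξ, p.2⟫) • caloricCoeff t m p.1 ξ) =
        fun p : ℝ × V => (𝐞 (-⟪ξ, p.2⟫) : ℂ) * caloricCoeff t m p.1 ξ := by
      funext p; rw [Circle.smul_def, smul_eq_mul]
    rw [hfun]
    refine Continuous.mul ?_ ?_
    · exact continuous_subtype_val.comp
        (continuous_fourierChar.comp (continuous_const.inner continuous_snd).neg)
    · exact ((continuous_caloricWeight t).comp (continuous_fst.prodMk continuous_const)).mul
        continuous_const

/-- Continuity in time at a fixed point, on `s ≤ t`. [folklore] -/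
theorem continuousOn_caloricSynth_left (hm : Integrable m) (t : ℝ) (x : V) :
    ContinuousOn (fun s => caloricSynth t m s x) (Iic t) := by
  have h := continuousOn_caloricSynth hm t
  have hf : Continuous fun s : ℝ => (s, x) := continuous_id.prodMk continuous_const
  exact h.comp (f := fun s : ℝ => (s, x)) hf.continuousOn fun s hs => mk_mem_prod hs (mem_univ x)

/-- Continuity in space at a fixed time `s ≤ t`. [folklore] -/
theorem continuous_caloricSynth_right (hm : Integrable m) (h : s ≤ t) :
    Continuous (caloricSynth t m s) :=
  Literature.Analysis.FunctionSpaces.continuous_fourierIntegral (integrable_caloricCoeff hm h)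

end Synth

/-! ### Space derivatives and the Laplacian of the synthesis -/

section SpaceDeriv

variable [InnerProductSpace ℝ V] [FiniteDimensional ℝ V] [MeasurableSpace V] [BorelSpace V]
variable {t s : ℝ} {m : V → ℂ}

/-- **`∂_h caloricSynth t m s = caloricSynth t (-2πi⟪ξ, h⟫ m) s`** at a time `s ≤ t`, for `m`
with integrable zeroth and first moments. [folklore] -/
theorem fderiv_caloricSynth_apply (hm : Integrable m)
    (hm1 : Integrable fun ξ : V => ‖ξ‖ * ‖m ξ‖) (h : s ≤ t) (x v : V) :
    fderiv ℝ (caloricSynth t m s) x v =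
      caloricSynth t (fun ξ => (-(2 * π * I) * (⟪ξ, v⟫ : ℂ)) * m ξ) s x := by
  have h0 : Integrable (caloricCoeff t m s) := integrable_caloricCoeff hm h
  have h1 : Integrable fun ξ : V => ‖ξ‖ * ‖caloricCoeff t m s ξ‖ := by
    simpa using integrable_pow_mul_norm_caloricCoeff (k := 1) hm.1 (by simpa using hm1) h
  have hdef : caloricSynth t m s = 𝓕 (caloricCoeff t m s) := rfl
  rw [hdef, fderiv_fourier_apply_of_moment h0 h1, caloricSynth, caloricCoeff_mul]

/-- The synthesis is differentiable in space at a time `s ≤ t` (first moment). [folklore] -/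
theorem differentiable_caloricSynth (hm : Integrable m)
    (hm1 : Integrable fun ξ : V => ‖ξ‖ * ‖m ξ‖) (h : s ≤ t) :
    Differentiable ℝ (caloricSynth t m s) := by
  have h0 : Integrable (caloricCoeff t m s) := integrable_caloricCoeff hm h
  have h1 : Integrable fun ξ : V => ‖ξ‖ * ‖caloricCoeff t m s ξ‖ := by
    simpa using integrable_pow_mul_norm_caloricCoeff (k := 1) hm.1 (by simpa using hm1) h
  exact Real.differentiable_fourier h0 h1

/-- **`caloricSynth t m s ∈ C^n`** at a time `s ≤ t`, for `m` with integrable moments of order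
`≤ n` (Mathlib `Real.contDiff_fourier`). [folklore] -/
theorem contDiff_caloricSynth {n : ℕ∞} (hmeas : AEStronglyMeasurable m volume)
    (hmom : ∀ k : ℕ, (k : ℕ∞) ≤ n → Integrable fun ξ : V => ‖ξ‖ ^ k * ‖m ξ‖) (h : s ≤ t) :
    ContDiff ℝ n (caloricSynth t m s) :=
  Real.contDiff_fourier fun k hk => integrable_pow_mul_norm_caloricCoeff hmeas (hmom k hk) h

/-- **`Δ caloricSynth t m s = caloricSynth t (-4π²‖ξ‖² m) s`** at a time `s ≤ t`, for `m` with
integrable moments of order `≤ 2`. [folklore] -/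
theorem laplacian_caloricSynth (hmeas : AEStronglyMeasurable m volume)
    (hmom : ∀ k : ℕ, k ≤ 2 → Integrable fun ξ : V => ‖ξ‖ ^ k * ‖m ξ‖) (h : s ≤ t) (x : V) :
    (Δ (caloricSynth t m s)) x =
      caloricSynth t (fun ξ => (-(4 * π ^ 2 * ‖ξ‖ ^ 2 : ℝ) : ℂ) * m ξ) s x := by
  have hdef : caloricSynth t m s = 𝓕 (caloricCoeff t m s) := rfl
  rw [hdef, laplacian_fourier_of_moment (aestronglyMeasurable_caloricCoeff hmeas t s)
    (fun k hk => integrable_pow_mul_norm_caloricCoeff hmeas (hmom k hk) h), caloricSynth,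
    caloricCoeff_mul]

end SpaceDeriv

/-! ### The time derivative: backward heat equation -/

section TimeDeriv

variable [InnerProductSpace ℝ V] [FiniteDimensional ℝ V] [MeasurableSpace V] [BorelSpace V]
variable {t s : ℝ} {m : V → ℂ}

/-- The symbol `(2π)²‖ξ‖²` multiplying `m` (the time derivative of the weight). [folklore] -/
theorem integrable_heatRate_mul (hmeas : AEStronglyMeasurable m volume)
    (hm2 : Integrable fun ξ : V => ‖ξ‖ ^ 2 * ‖m ξ‖) :
    Integrable fun ξ : V => (((2 * π) ^ 2 * ‖ξ‖ ^ 2 : ℝ) : ℂ) * m ξ := by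
  refine (hm2.const_mul ((2 * π) ^ 2)).mono' ?_ (Eventually.of_forall fun ξ => ?_)
  · exact (Continuous.aestronglyMeasurable (by fun_prop)).mul hmeas
  · rw [norm_mul, Complex.norm_real, Real.norm_of_nonneg (by positivity)]
    exact le_of_eq (by ring)

/-- **Backward heat equation on the Fourier side.** For `s < t` and `m` with integrable moments
of order `0` and `2`,
`∂ₛ caloricSynth t m s x = caloricSynth t ((2π)²‖ξ‖² m) s x`
(differentiation under the integral sign, dominating function `(2π)²‖ξ‖²‖m ξ‖` on the ball of
radius `(t - s)/2` around `s`). [folklore] -/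
theorem hasDerivAt_caloricSynth (hm : Integrable m)
    (hm2 : Integrable fun ξ : V => ‖ξ‖ ^ 2 * ‖m ξ‖) (hs : s < t) (x : V) :
    HasDerivAt (fun σ => caloricSynth t m σ x)
      (caloricSynth t (fun ξ => (((2 * π) ^ 2 * ‖ξ‖ ^ 2 : ℝ) : ℂ) * m ξ) s x) s := by
  set ε : ℝ := (t - s) / 2 with hε
  have hε0 : 0 < ε := by rw [hε]; linarith
  have hball : ∀ σ ∈ Metric.ball s ε, σ ≤ t := fun σ hσ => by
    have := Metric.mem_ball.1 hσ
    rw [Real.dist_eq] at this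
    have := (abs_lt.1 this).2
    rw [hε] at this
    linarith
  -- the integrands
  set F : ℝ → V → ℂ := fun σ ξ => 𝐞 (-⟪ξ, x⟫) • caloricCoeff t m σ ξ with hF
  set F' : ℝ → V → ℂ := fun σ ξ =>
    𝐞 (-⟪ξ, x⟫) • caloricCoeff t (fun ξ => (((2 * π) ^ 2 * ‖ξ‖ ^ 2 : ℝ) : ℂ) * m ξ) σ ξ with hF'
  have hrate := integrable_heatRate_mul hm.1 hm2
  have hF_meas : ∀ σ, AEStronglyMeasurable (F σ) volume := fun σ =>
    (continuous_fourierChar.comp (continuous_id.inner continuous_const).neg).aestronglyMeasurable.smul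
      (aestronglyMeasurable_caloricCoeff hm.1 t σ)
  have hF'_meas : ∀ σ, AEStronglyMeasurable (F' σ) volume := fun σ =>
    (continuous_fourierChar.comp (continuous_id.inner continuous_const).neg).aestronglyMeasurable.smul
      (aestronglyMeasurable_caloricCoeff hrate.1 t σ)
  have hF_int : Integrable (F s) :=
    (Real.fourierIntegral_convergent_iff x).2 (integrable_caloricCoeff hm hs.le)
  have h_bound : ∀ᵐ ξ ∂(volume : Measure V), ∀ σ ∈ Metric.ball s ε,
      ‖F' σ ξ‖ ≤ (2 * π) ^ 2 * (‖ξ‖ ^ 2 * ‖m ξ‖) := by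
    refine Eventually.of_forall fun ξ σ hσ => ?_
    rw [hF', Circle.norm_smul]
    refine (norm_caloricCoeff_le (hball σ hσ) ξ).trans (le_of_eq ?_)
    rw [norm_mul, Complex.norm_real, Real.norm_of_nonneg (by positivity)]
    ring
  have h_diff : ∀ᵐ ξ ∂(volume : Measure V), ∀ σ ∈ Metric.ball s ε,
      HasDerivAt (fun σ => F σ ξ) (F' σ ξ) σ := by
    refine Eventually.of_forall fun ξ σ _ => ?_
    simp only [hF, hF', caloricCoeff, Circle.smul_def, smul_eq_mul]
    have h1 := ((hasDerivAt_caloricWeight t σ ξ).mul_const (m ξ)).const_mul (𝐞 (-⟪ξ, x⟫) : ℂ)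
    exact h1.congr_deriv (by ring)
  have key := (hasDerivAt_integral_of_dominated_loc_of_deriv_le (Metric.ball_mem_nhds s hε0)
    (Eventually.of_forall hF_meas) hF_int (hF'_meas s) h_bound (hm2.const_mul _) h_diff).2
  have hL : (fun σ => caloricSynth t m σ x) = fun σ => ∫ ξ, F σ ξ := by
    funext σ; rw [caloricSynth_eq_integral]
  rw [hL, caloricSynth_eq_integral]
  exact key

/-- The time-derivative coefficient is minus the Laplacian coefficient:
`caloricSynth t ((2π)²‖ξ‖² m) s x = -(Δ caloricSynth t m s) x` (`s ≤ t`, moments `≤ 2`). [folklore] -/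
theorem caloricSynth_heatRate_eq_neg_laplacian (hmeas : AEStronglyMeasurable m volume)
    (hmom : ∀ k : ℕ, k ≤ 2 → Integrable fun ξ : V => ‖ξ‖ ^ k * ‖m ξ‖) (h : s ≤ t) (x : V) :
    caloricSynth t (fun ξ => (((2 * π) ^ 2 * ‖ξ‖ ^ 2 : ℝ) : ℂ) * m ξ) s x =
      -(Δ (caloricSynth t m s)) x := by
  rw [laplacian_caloricSynth hmeas hmom h, caloricSynth_eq_integral, caloricSynth_eq_integral,
    ← integral_neg]
  refine integral_congr_ae (Eventually.of_forall fun ξ => ?_)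
  simp only [caloricCoeff, Circle.smul_def, smul_eq_mul]
  push_cast
  ring

/-- **Backward heat equation** for the synthesis: for `s < t` and `m` with integrable moments of
order `≤ 2`, `∂ₛ caloricSynth t m s x = -(Δₓ caloricSynth t m s) x`. [folklore] -/
theorem hasDerivAt_caloricSynth_neg_laplacian (hmeas : AEStronglyMeasurable m volume)
    (hmom : ∀ k : ℕ, k ≤ 2 → Integrable fun ξ : V => ‖ξ‖ ^ k * ‖m ξ‖) (hs : s < t) (x : V) :
    HasDerivAt (fun σ => caloricSynth t m σ x) (-(Δ (caloricSynth t m s)) x) s := by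
  have hm : Integrable m := integrable_of_integrable_pow_zero_mul hmeas (hmom 0 (by norm_num))
  rw [← caloricSynth_heatRate_eq_neg_laplacian hmeas hmom hs.le x]
  exact hasDerivAt_caloricSynth hm (hmom 2 le_rfl) hs x

end TimeDeriv

/-! ### The `L²` bound (Plancherel) -/

section L2

variable [InnerProductSpace ℝ V] [FiniteDimensional ℝ V] [MeasurableSpace V] [BorelSpace V]
variable {t s : ℝ} {m : V → ℂ}

/-- The synthesis of `m ∈ L¹ ∩ L²` is in `L²` at every time `s ≤ t`. [folklore] -/
theorem memLp_two_caloricSynth (hm : Integrable m) (hm2 : MemLp m 2 volume) (h : s ≤ t) :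
    MemLp (caloricSynth t m s) 2 volume :=
  Literature.Analysis.FunctionSpaces.memLp_two_fourierIntegral (integrable_caloricCoeff hm h)
    (memLp_two_caloricCoeff hm2 h)

/-- **`L²` bound**: `∫ ‖caloricSynth t m s x‖² dx ≤ ∫ ‖m ξ‖² dξ` for `m ∈ L¹ ∩ L²`, `s ≤ t`
(Plancherel on `L¹ ∩ L²` and `|weight| ≤ 1`). [folklore] -/
theorem lintegral_enorm_sq_caloricSynth_le (hm : Integrable m) (hm2 : MemLp m 2 volume)
    (h : s ≤ t) :
    ∫⁻ x, ‖caloricSynth t m s x‖ₑ ^ 2 ≤ ∫⁻ ξ, ‖m ξ‖ₑ ^ 2 := by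
  have hP := Literature.Analysis.FunctionSpaces.lintegral_enorm_sq_fourierIntegral_eq
    (integrable_caloricCoeff hm h) (memLp_two_caloricCoeff hm2 h)
  change ∫⁻ x, ‖𝓕 (caloricCoeff t m s) x‖ₑ ^ 2 ≤ _
  rw [hP]
  refine lintegral_mono fun ξ => ?_
  gcongr
  rw [← ofReal_norm, ← ofReal_norm]
  exact ENNReal.ofReal_le_ofReal (norm_caloricCoeff_le h ξ)

/-- `eLpNorm` form of the `L²` bound: `‖caloricSynth t m s‖_{L²} ≤ ‖m‖_{L²}`. [folklore] -/
theorem eLpNorm_caloricSynth_le (hm : Integrable m) (hm2 : MemLp m 2 volume) (h : s ≤ t) :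
    eLpNorm (caloricSynth t m s) 2 volume ≤ eLpNorm m 2 volume := by
  rw [eLpNorm_eq_lintegral_rpow_enorm_toReal two_ne_zero ENNReal.ofNat_ne_top,
    eLpNorm_eq_lintegral_rpow_enorm_toReal two_ne_zero ENNReal.ofNat_ne_top]
  simp only [ENNReal.toReal_ofNat, one_div]
  gcongr ?_ ^ _
  simpa [ENNReal.rpow_two] using lintegral_enorm_sq_caloricSynth_le hm hm2 h

end L2

/-! ### The heat flow of a synthesis -/

section HeatFlow

variable [InnerProductSpace ℝ V] [FiniteDimensional ℝ V] [MeasurableSpace V] [BorelSpace V]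
variable {m : V → ℂ} {τ : ℝ}

/-- The inverse-sign Fourier integral of the heat kernel against a character:
`∫ heatKernel τ y · 𝐞(-⟪ξ, x - y⟫) dy = 𝐞(-⟪ξ, x⟫) heatSymbol τ ξ` (`τ > 0`; from
`𝓕 (heatKernel τ) = heatSymbol τ` and evenness of the symbol). [folklore] -/
theorem integral_heatKernel_mul_fourierChar (hτ : 0 < τ) (ξ x : V) :
    ∫ y, ((heatKernel τ y : ℝ) : ℂ) * (𝐞 (-⟪ξ, x - y⟫) : ℂ) =
      (𝐞 (-⟪ξ, x⟫) : ℂ) * ((heatSymbol τ ξ : ℝ) : ℂ) := by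
  have hF := fourierIntegral_heatKernel_holds (E := V) hτ (-ξ)
  rw [Real.fourier_eq] at hF
  have hsym : heatSymbol τ (-ξ) = heatSymbol τ ξ := by simp [heatSymbol, norm_neg]
  rw [hsym] at hF
  have hchar : ∀ y : V, (𝐞 (-⟪ξ, x - y⟫) : ℂ) = 𝐞 (-⟪ξ, x⟫) * 𝐞 (-⟪y, -ξ⟫) := by
    intro y
    rw [← Circle.coe_mul, ← AddChar.map_add_eq_mul]
    congr 2
    rw [inner_sub_right, inner_neg_right, real_inner_comm y ξ]
    ring
  simp_rw [hchar]
  calc ∫ y, ((heatKernel τ y : ℝ) : ℂ) * ((𝐞 (-⟪ξ, x⟫) : ℂ) * 𝐞 (-⟪y, -ξ⟫))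
      = (𝐞 (-⟪ξ, x⟫) : ℂ) * ∫ y, (𝐞 (-⟪y, -ξ⟫) : ℂ) * ((heatKernel τ y : ℝ) : ℂ) := by
        rw [← integral_const_mul]
        exact integral_congr_ae (Eventually.of_forall fun y => by ring)
    _ = (𝐞 (-⟪ξ, x⟫) : ℂ) * ((heatSymbol τ ξ : ℝ) : ℂ) := by
        rw [← hF]
        simp only [Circle.smul_def, smul_eq_mul]

/-- **The heat flow of a Fourier synthesis is the synthesis of the damped coefficient**:
`e^{τΔ}(𝓕 m)(x) = 𝓕 (heatSymbol τ · m)(x)` for `m ∈ L¹(V)`, `τ > 0` (Fubini: the integrand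
`heatKernel τ y · 𝐞(-⟪ξ, x - y⟫) m(ξ)` is integrable on `V × V`; then
`𝓕 (heatKernel τ) = heatSymbol τ`). Evans, *PDE*, §4.3.1 (b). [folklore] -/
theorem heatExtension_fourier_eq (hm : Integrable m) (hτ : 0 < τ) (x : V) :
    heatExtension (𝓕 m) τ x = 𝓕 (fun ξ => ((heatSymbol τ ξ : ℝ) : ℂ) * m ξ) x := by
  rw [heatExtension_apply, Real.fourier_eq]
  have hG := integrable_heatKernel_holds (E := V) hτ
  -- the product integrand on `V × V` (`y` outer, `ξ` inner)
  set H : V → V → ℂ := fun y ξ => ((heatKernel τ y : ℝ) : ℂ) * ((𝐞 (-⟪ξ, x - y⟫) : ℂ) * m ξ)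
    with hH
  have hHmeas : AEStronglyMeasurable (uncurry H) (volume.prod volume) := by
    refine Continuous.aestronglyMeasurable ?_ |>.mul ?_
    · exact Complex.continuous_ofReal.comp ((continuous_heatKernel τ).comp continuous_fst)
    · refine Continuous.aestronglyMeasurable ?_ |>.mul hm.1.comp_snd
      exact continuous_subtype_val.comp (continuous_fourierChar.comp
        ((continuous_snd.inner (continuous_const.sub continuous_fst)).neg))
  have hHint : Integrable (uncurry H) (volume.prod volume) := by
    have hprod : Integrable (fun p : V × V => heatKernel τ p.1 * ‖m p.2‖) (volume.prod volume) :=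
      hG.mul_prod hm.norm
    refine hprod.mono' hHmeas (Eventually.of_forall fun p => ?_)
    simp only [hH, uncurry, norm_mul, Complex.norm_real, Circle.norm_coe, one_mul,
      Real.norm_of_nonneg (heatKernel_pos hτ _).le]
    exact le_rfl
  -- rewrite both sides as iterated integrals of `H`
  have hL : ∀ y, heatKernel τ y • 𝓕 m (x - y) = ∫ ξ, H y ξ := fun y => by
    rw [Real.fourier_eq, Complex.real_smul, ← integral_const_mul]
    refine integral_congr_ae (Eventually.of_forall fun ξ => ?_)
    simp only [hH, Circle.smul_def, smul_eq_mul]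
  simp_rw [hL]
  rw [integral_integral_swap hHint]
  refine integral_congr_ae (Eventually.of_forall fun ξ => ?_)
  simp only [hH, Circle.smul_def, smul_eq_mul]
  calc ∫ y, ((heatKernel τ y : ℝ) : ℂ) * ((𝐞 (-⟪ξ, x - y⟫) : ℂ) * m ξ)
      = (∫ y, ((heatKernel τ y : ℝ) : ℂ) * (𝐞 (-⟪ξ, x - y⟫) : ℂ)) * m ξ := by
        rw [← integral_mul_const]
        exact integral_congr_ae (Eventually.of_forall fun y => by ring)
    _ = (𝐞 (-⟪ξ, x⟫) : ℂ) * (((heatSymbol τ ξ : ℝ) : ℂ) * m ξ) := by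
        rw [integral_heatKernel_mul_fourierChar hτ ξ x]; ring

/-- The heat flow commutes with taking real parts: for a bounded continuous `g : V → ℂ` and
`τ > 0`, `e^{τΔ}(Re g) = Re (e^{τΔ} g)`. [folklore] -/
theorem heatExtension_re_eq {g : V → ℂ} (hg : Continuous g) {C : ℝ} (hC : ∀ x, ‖g x‖ ≤ C)
    (hτ : 0 < τ) (x : V) :
    heatExtension (fun y => (g y).re) τ x = (heatExtension g τ x).re := by
  rw [heatExtension_apply, heatExtension_apply]
  have hint : Integrable (fun y => heatKernel τ y • g (x - y)) := by
    have hG := integrable_heatKernel_holds (E := V) hτ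
    refine (hG.norm.mul_const C).mono' ?_ (Eventually.of_forall fun y => ?_)
    · exact hG.1.smul (hg.comp (continuous_const.sub continuous_id)).aestronglyMeasurable
    · rw [norm_smul]
      exact mul_le_mul_of_nonneg_left (hC _) (norm_nonneg _)
  have h : ∫ y, (heatKernel τ y • g (x - y)).re = (∫ y, heatKernel τ y • g (x - y)).re := by
    have := Complex.reCLM.integral_comp_comm hint
    simpa using this
  rw [← h]
  refine integral_congr_ae (Eventually.of_forall fun y => ?_)
  simp only [Complex.smul_re, smul_eq_mul]

/-- **Heat flow of the real part of a synthesis**: for `m ∈ L¹(V)` and `τ > 0`,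
`e^{τΔ}(Re 𝓕 m)(x) = Re 𝓕 (heatSymbol τ · m)(x)`. [folklore] -/
theorem heatExtension_re_fourier_eq (hm : Integrable m) (hτ : 0 < τ) (x : V) :
    heatExtension (fun y => (𝓕 m y).re) τ x =
      (𝓕 (fun ξ => ((heatSymbol τ ξ : ℝ) : ℂ) * m ξ) x).re := by
  rw [heatExtension_re_eq (Literature.Analysis.FunctionSpaces.continuous_fourierIntegral hm)
    (fun y => VectorFourier.norm_fourierIntegral_le_integral_norm _ _ _ _ _) hτ,
    heatExtension_fourier_eq hm hτ]

/-- The heat flow of a synthesis in caloric notation: for `m ∈ L¹`, `s < t`,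
`e^{(t-s)Δ}(𝓕 m) = caloricSynth t m s`. [folklore] -/
theorem heatExtension_fourier_eq_caloricSynth (hm : Integrable m) {t s : ℝ} (hs : s < t) (x : V) :
    heatExtension (𝓕 m) (t - s) x = caloricSynth t m s x := by
  rw [heatExtension_fourier_eq hm (sub_pos.2 hs)]
  rfl

end HeatFlow

end Literature.Analysis.UnboundedOperators

end
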